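import Summits.QuantumFields.YangMills.Theorems.BalabanUVNodesN07TorusBoxCutoffCore
import HarnessLib

/-!
# DAG node N07 — C^{1,1} PRODUCT BOX CUT-OFFS ON THE TORUS `(ℤ∕N)^d` with controlled FIRST AND SECOND differences
# (the geometric input of the interior plate-energy estimate for discrete biharmonic functions)

Width seat `pub-ymgap-dag-n07-w7` (g6), count-neutral helper (`--supports … --as helper`); companion of this seat's
`…Theorems.BalabanUVNodesN07PlateCaccioppoliBiharmonic` (p639356: `biharmonic_plate_step` takes its cut-offs as hypotheses with
`|∂χ| ≤ δ`, `|∂∂χ| ≤ δ²`) on g3's calculus (`fd` on `TorusSite d N = Fin d → ZMod N`).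

WHAT.  For a centre `z`, a radius `R` and a width `w` (`1 ≤ w ≤ R`, `2(R + w + 3) ≤ N`):
★★ `exists_torusBoxCutoff` — a function `χ : TorusSite d N → [0,1]` with `χ = 1` on the box `{x | ∀ i, |x_i − z_i| ≤ R − w + 1}`,
`χ = 0` off the box of radius `R + w − 1`, `|∂ᵢχ| ≤ 1∕w` and `|∂ⱼ∂ᵢχ| ≤ 2∕w²` for all `i, j` (here `|x_i − z_i|` is the torus
distance `|valMinAbs(x_i − z_i)|`).  Construction: the product over coordinates of the AVERAGED RAMP
`g(k) = w⁻¹Σ_{s<w} clamp((R + w − k − s)∕w)` of the coordinate distance — averaging a `1∕w`-Lipschitz ramp over a window of `w`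
steps makes the SECOND difference telescope to `≤ 2∕w²` (§1), the coordinate distance moves by `±1` per lattice step and by
exactly `±1` away from the centre and the antipode (§2, `ZMod.valMinAbs_spec`), and products of `[0,1]`-valued one-coordinate
factors inherit the bounds (§3).
* §1 `abs_clamp_sub_clamp_le`, the ramp and the averaged ramp (hypothesis-form letters `hr`, `hg`;
  no definition is introduced): `ramp_eq_one`, `ramp_eq_zero`, `abs_ramp_succ_sub_le`, `avgRamp_succ_sub`, ★ `abs_avgRamp_succ_sub_le`,
  ★ `abs_avgRamp_second_le`, `avgRamp_eq_one`, `avgRamp_eq_zero`, `avgRamp_mem`;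
* §2 the torus coordinate distance: the one-step bounds are the tree's `BIJ85TorusTentCutoff.natAbs_valMinAbs_succ_le` ∕
  `natAbs_valMinAbs_le_succ` (BY NAME); ★ `valMinAbs_add_natCast_eq` (exact steps away from the antipode);
* §3 ★ `coordCutoff_bounds` (one coordinate), §4 `prod_sub_prod_of_eq_off`, ★★ `prodCutoff_bounds`, §5 ★★ `exists_torusBoxCutoff`.
The tree's neighbours: `BIJ85TorusTentCutoff` (product TENT cut-off on `Site P j`: first differences `≤ 1∕r`, second differences
`≤ 2∕r` concentrated on two kink slabs — here the averaged ramp spreads them to `≤ 2∕w²` POINTWISE, which the plate estimate needs;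
its `ZMod` step lemmas are reused BY NAME), `B4Eq19LatticeCaccioppoli.exists_cutoff` (`ℤᵈ`), `B9Ineq346SecondOrderTorusCutoff` (`boxDom`).

HONEST SCOPE.  Elementary real ∕ modular arithmetic; asserts NOTHING about [B11]∕[B6]∕[3]; the iteration that turns
`biharmonic_plate_step` + these cut-offs into `Σ_{B_ρ}(Δh)² ≤ C(d)(r−ρ)⁻⁴Σ_{B_r}h²` is the sequel
`…N07BiharmonicInteriorEstimate`; (P)_D for Bałaban's `d = 4` geometries OPEN; `hker` at the record, stub 1, K0⁷ ∕ K1⁹ NOT closed;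
N07 not discharged; nothing continuum ∕ OS ∕ mass gap.  Context only: M. Giaquinta (1983) Ch. III §2 [Giaquinta1984].

FILE SPLIT (400-line cap): §1–§2 live in the CORE file `…N07TorusBoxCutoffCore`; this file is §3–§5.
-/

set_option autoImplicit false

noncomputable section

open Finset

namespace Summit.QuantumFields.YangMills.Theorems.N07TorusBoxCutoff

open Literature.Probability.LatticeModels (TorusSite)
open Summit.QuantumFields.YangMills.Theorems.N07PointFeasibilityEnergyIdentity (fd)
open Literature.MathematicalPhysics.QuantumFieldTheory.BalabanImbrieJaffe1984to88.BIJ85TorusTentCutoff (natAbs_valMinAbs_succ_le natAbs_valMinAbs_le_succ)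

/-! ## §3  One coordinate: the averaged ramp of the torus coordinate distance -/

section OneCoord

variable {N : ℕ} [NeZero N] {R w : ℕ}

/-- ★ **One-coordinate cut-off bounds.**  With `G(v) = g(|valMinAbs(v − c)|)` (`g` the averaged ramp of radius `R`, width
`w`, `1 ≤ w ≤ R`, `2(R + w) + 7 ≤ N`): `0 ≤ G ≤ 1`, `|G(v+1) − G(v)| ≤ 1∕w`, `|G(v+2) − 2G(v+1) + G(v)| ≤ 2∕w²`. [folklore] -/
theorem coordCutoff_bounds (r : ℕ → ℝ) (hr : r = fun m : ℕ => min 1 (max 0 (((R : ℝ) + w - m) / w)))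
    (g : ℕ → ℝ) (hg : g = fun k : ℕ => (1 / (w : ℝ)) * ∑ s ∈ Finset.range w, r (k + s))
    (hw : 1 ≤ w) (hwR : w ≤ R) (hN : 2 * (R + w) + 7 ≤ N) (c : ZMod N)
    (G : ZMod N → ℝ) (hG : G = fun v => g (v - c).valMinAbs.natAbs) (v : ZMod N) :
    (0 ≤ G v ∧ G v ≤ 1) ∧ |G (v + 1) - G v| ≤ 1 / w ∧ |G (v + 1 + 1) - 2 * G (v + 1) + G v| ≤ 2 / (w : ℝ) ^ 2 := by
  have hN3 : 3 ≤ N := by omega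
  have hw0 : (0 : ℝ) < w := by exact_mod_cast hw
  -- the three distances
  set t : ℤ := (v - c).valMinAbs with ht
  have e1 : v + 1 - c = (v - c) + ((1 : ℕ) : ZMod N) := by push_cast; ring
  have e2 : v + 1 + 1 - c = (v - c) + ((2 : ℕ) : ZMod N) := by push_cast; ring
  -- Lipschitz steps
  have L1 : (v + 1 - c).valMinAbs.natAbs ≤ t.natAbs + 1 := by
    rw [show v + 1 - c = (v - c) + 1 by ring]; exact natAbs_valMinAbs_succ_le hN3 _
  have L1' : t.natAbs ≤ (v + 1 - c).valMinAbs.natAbs + 1 := by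
    have := natAbs_valMinAbs_le_succ hN3 (v - c)
    rwa [show v - c + 1 = v + 1 - c by ring] at this
  have L2 : (v + 1 + 1 - c).valMinAbs.natAbs ≤ (v + 1 - c).valMinAbs.natAbs + 1 := by
    rw [show v + 1 + 1 - c = (v + 1 - c) + 1 by ring]; exact natAbs_valMinAbs_succ_le hN3 _
  have L2' : (v + 1 - c).valMinAbs.natAbs ≤ (v + 1 + 1 - c).valMinAbs.natAbs + 1 := by
    have := natAbs_valMinAbs_le_succ hN3 (v + 1 - c)
    rwa [show v + 1 - c + 1 = v + 1 + 1 - c by ring] at this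
  have hGv : ∀ u : ZMod N, G u = g (u - c).valMinAbs.natAbs := fun u => by rw [hG]
  refine ⟨?_, ?_, ?_⟩
  · rw [hGv]; exact avgRamp_mem r hr g hg hw _
  · -- first difference: the distance moves by at most one
    rw [hGv, hGv]
    set k0 := t.natAbs with hk0
    set k1 := (v + 1 - c).valMinAbs.natAbs with hk1
    rcases Nat.lt_trichotomy k1 k0 with hlt | heq | hgt
    · have : k0 = k1 + 1 := by omega
      rw [this, abs_sub_comm]; exact abs_avgRamp_succ_sub_le r hr g hg hw k1
    · rw [heq, sub_self, abs_zero]; positivity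
    · have : k1 = k0 + 1 := by omega
      rw [this]; exact abs_avgRamp_succ_sub_le r hr g hg hw k0
  · -- second difference
    rw [hGv, hGv, hGv]
    have hk0' : (v - c).valMinAbs.natAbs = t.natAbs := by rw [ht]
    rw [hk0']
    by_cases hfar : 2 * (t.natAbs + 2) ≤ N
    · -- exact steps: the three distances are |t|, |t+1|, |t+2|
      have s1 : (v + 1 - c).valMinAbs = t + 1 := by
        rw [e1, valMinAbs_add_natCast_eq (v - c) 1 (by omega)]; simp [ht]
      have s2 : (v + 1 + 1 - c).valMinAbs = t + 2 := by
        rw [e2, valMinAbs_add_natCast_eq (v - c) 2 (by omega)]; simp [ht]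
      rw [s1, s2]
      rcases le_or_gt 0 t with hpos | hneg
      · -- ascending
        have a0 : (t + 1).natAbs = t.natAbs + 1 := by omega
        have a1 : (t + 2).natAbs = t.natAbs + 2 := by omega
        rw [a0, a1]
        have := abs_avgRamp_second_le r hr g hg hw t.natAbs
        rwa [show g (t.natAbs + 2) - 2 * g (t.natAbs + 1) + g t.natAbs =
          g (t.natAbs + 2) - 2 * g (t.natAbs + 1) + g t.natAbs from rfl]
      · rcases eq_or_lt_of_le (show t ≤ -1 by omega) with ht1 | ht2
        · -- t = -1: distances 1, 0, 1 and g(0) = g(1) = 1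
          have a0 : t.natAbs = 1 := by omega
          have a1 : (t + 1).natAbs = 0 := by omega
          have a2 : (t + 2).natAbs = 1 := by omega
          rw [a0, a1, a2, avgRamp_eq_one r hr g hg hw (by omega), avgRamp_eq_one r hr g hg hw (by omega)]
          norm_num; positivity
        · -- descending: distances m+2, m+1, m
          have a0 : t.natAbs = (t + 2).natAbs + 2 := by omega
          have a1 : (t + 1).natAbs = (t + 2).natAbs + 1 := by omega
          rw [a0, a1]
          have := abs_avgRamp_second_le r hr g hg hw (t + 2).natAbs
          rw [show g ((t + 2).natAbs + 2) - 2 * g ((t + 2).natAbs + 1) + g (t + 2).natAbs =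
            g ((t + 2).natAbs + 2) - 2 * g ((t + 2).natAbs + 1) + g (t + 2).natAbs from rfl] at this
          rwa [show g (t + 2).natAbs - 2 * g ((t + 2).natAbs + 1) + g ((t + 2).natAbs + 2) =
            g ((t + 2).natAbs + 2) - 2 * g ((t + 2).natAbs + 1) + g (t + 2).natAbs by ring]
    · -- near the antipode all three distances are ≥ R + w, so all three values vanish
      push Not at hfar
      have b0 : R + w ≤ t.natAbs := by omega
      have b1 : R + w ≤ (v + 1 - c).valMinAbs.natAbs := by omega
      have b2 : R + w ≤ (v + 1 + 1 - c).valMinAbs.natAbs := by omega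
      rw [avgRamp_eq_zero r hr g hg hw b0, avgRamp_eq_zero r hr g hg hw b1, avgRamp_eq_zero r hr g hg hw b2]
      norm_num; positivity

omit [NeZero N] in
/-- The one-coordinate cut-off is `1` within distance `R − w + 1` and `0` beyond `R + w`. [folklore] -/
theorem coordCutoff_eq (r : ℕ → ℝ) (hr : r = fun m : ℕ => min 1 (max 0 (((R : ℝ) + w - m) / w)))
    (g : ℕ → ℝ) (hg : g = fun k : ℕ => (1 / (w : ℝ)) * ∑ s ∈ Finset.range w, r (k + s))
    (hw : 1 ≤ w) (c : ZMod N)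
    (G : ZMod N → ℝ) (hG : G = fun v => g (v - c).valMinAbs.natAbs) (v : ZMod N) :
    ((v - c).valMinAbs.natAbs + w ≤ R + 1 → G v = 1) ∧ (R + w ≤ (v - c).valMinAbs.natAbs → G v = 0) := by
  refine ⟨fun h1 => ?_, fun h2 => ?_⟩
  · rw [hG]; exact avgRamp_eq_one r hr g hg hw h1
  · rw [hG]; exact avgRamp_eq_zero r hr g hg hw h2

end OneCoord

/-! ## §4  The product cut-off on `TorusSite d N` -/

section Product

variable {d N : ℕ} [NeZero N]

/-- Changing one coordinate in a product of reals: `∏_s a − ∏_s b = (a l − b l)·∏_{s ∖ l} b` when `a = b` off `l ∈ s`.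
[folklore] -/
theorem prod_sub_prod_of_eq_off {ι : Type*} [DecidableEq ι] (s : Finset ι) (a b : ι → ℝ) {l : ι} (hl : l ∈ s)
    (hab : ∀ i ∈ s, i ≠ l → a i = b i) :
    ∏ i ∈ s, a i - ∏ i ∈ s, b i = (a l - b l) * ∏ i ∈ s.erase l, b i := by
  rw [← Finset.mul_prod_erase s a hl, ← Finset.mul_prod_erase s b hl]
  have : ∏ i ∈ s.erase l, a i = ∏ i ∈ s.erase l, b i :=
    Finset.prod_congr rfl (fun i hi => hab i (Finset.mem_of_mem_erase hi) (Finset.ne_of_mem_erase hi))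
  rw [this]; ring

omit [NeZero N] in
/-- ★★ **The product cut-off and its bounds.**  For one-coordinate factors `F i : ZMod N → [0,1]` with `|F i (v+1) − F i v| ≤ a`
and `|F i (v+2) − 2F i (v+1) + F i v| ≤ b`, the product `χ(x) = Π_i F i (x_i)` satisfies `0 ≤ χ ≤ 1`, `|∂ⱼχ| ≤ a`,
`|∂ⱼ∂ⱼχ| ≤ b` and `|∂ₗ∂ⱼχ| ≤ a²` for `l ≠ j`. [folklore] -/
theorem prodCutoff_bounds (F : Fin d → ZMod N → ℝ) {a b : ℝ} (ha : 0 ≤ a) (h01 : ∀ i v, 0 ≤ F i v ∧ F i v ≤ 1)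
    (h1 : ∀ i v, |F i (v + 1) - F i v| ≤ a) (h2 : ∀ i v, |F i (v + 1 + 1) - 2 * F i (v + 1) + F i v| ≤ b)
    (χ : TorusSite d N → ℝ) (hχ : χ = fun x => ∏ i, F i (x i)) :
    (∀ x, 0 ≤ χ x ∧ χ x ≤ 1) ∧ (∀ j x, |fd j χ x| ≤ a) ∧ (∀ j x, |fd j (fd j χ) x| ≤ b) ∧
      (∀ l j x, l ≠ j → |fd l (fd j χ) x| ≤ a ^ 2) := by
  classical
  -- products of `[0,1]`-valued factors lie in `[0,1]` (cf. the tree's `ChartHInv.prod_mem_unit`)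
  have hP : ∀ (s : Finset (Fin d)) (y : TorusSite d N), 0 ≤ ∏ i ∈ s, F i (y i) ∧ ∏ i ∈ s, F i (y i) ≤ 1 :=
    fun s y => ⟨Finset.prod_nonneg (fun i _ => (h01 i (y i)).1),
      Finset.prod_le_one (fun i _ => (h01 i (y i)).1) (fun i _ => (h01 i (y i)).2)⟩
  -- the first difference factorises
  have hfd : ∀ (j : Fin d) (x : TorusSite d N),
      fd j χ x = (F j (x j + 1) - F j (x j)) * ∏ i ∈ Finset.univ.erase j, F i (x i) := by
    intro j x
    rw [hχ]; simp only [fd]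
    have step := prod_sub_prod_of_eq_off Finset.univ (fun i => F i ((x + Pi.single j 1 : TorusSite d N) i))
      (fun i => F i (x i)) (Finset.mem_univ j) (fun i _ hij => by
        show F i ((x + Pi.single j 1 : TorusSite d N) i) = F i (x i)
        rw [Pi.add_apply, Pi.single_eq_of_ne hij, add_zero])
    have hjj : (x + Pi.single j 1 : TorusSite d N) j = x j + 1 := by rw [Pi.add_apply, Pi.single_eq_same]
    rw [hjj] at step
    exact step
  -- shifted coordinates
  have hshift_ne : ∀ (l i : Fin d) (x : TorusSite d N), i ≠ l → (x + Pi.single l 1 : TorusSite d N) i = x i :=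
    fun l i x hil => by rw [Pi.add_apply, Pi.single_eq_of_ne hil, add_zero]
  have hshift_eq : ∀ (l : Fin d) (x : TorusSite d N), (x + Pi.single l 1 : TorusSite d N) l = x l + 1 :=
    fun l x => by rw [Pi.add_apply, Pi.single_eq_same]
  refine ⟨fun x => by rw [hχ]; exact hP _ x, fun j x => ?_, fun j x => ?_, fun l j x hlj => ?_⟩
  · rw [hfd, abs_mul]
    have hp := hP (Finset.univ.erase j) x
    calc |F j (x j + 1) - F j (x j)| * |∏ i ∈ Finset.univ.erase j, F i (x i)| ≤ a * 1 := by
          rw [abs_of_nonneg hp.1]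
          exact mul_le_mul (h1 j (x j)) hp.2 hp.1 ha
      _ = a := mul_one a
  · -- same coordinate twice
    have e : fd j (fd j χ) x = (F j (x j + 1 + 1) - 2 * F j (x j + 1) + F j (x j)) *
        ∏ i ∈ Finset.univ.erase j, F i (x i) := by
      rw [show fd j (fd j χ) x = fd j χ (x + Pi.single j 1) - fd j χ x from rfl, hfd, hfd, hshift_eq]
      have hpr : ∏ i ∈ Finset.univ.erase j, F i ((x + Pi.single j 1 : TorusSite d N) i) =
          ∏ i ∈ Finset.univ.erase j, F i (x i) :=
        Finset.prod_congr rfl (fun i hi => by rw [hshift_ne j i x (Finset.ne_of_mem_erase hi)])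
      rw [hpr]
      ring
    rw [e, abs_mul]
    have hp := hP (Finset.univ.erase j) x
    have hb : 0 ≤ b := le_trans (abs_nonneg _) (h2 j (x j))
    calc |F j (x j + 1 + 1) - 2 * F j (x j + 1) + F j (x j)| * |∏ i ∈ Finset.univ.erase j, F i (x i)| ≤ b * 1 := by
          rw [abs_of_nonneg hp.1]
          exact mul_le_mul (h2 j (x j)) hp.2 hp.1 hb
      _ = b := mul_one b
  · -- two different coordinates
    have hl : l ∈ Finset.univ.erase j := Finset.mem_erase.mpr ⟨hlj, Finset.mem_univ l⟩
    have e : fd l (fd j χ) x = (F j (x j + 1) - F j (x j)) * ((F l (x l + 1) - F l (x l)) *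
        ∏ i ∈ (Finset.univ.erase j).erase l, F i (x i)) := by
      rw [show fd l (fd j χ) x = fd j χ (x + Pi.single l 1) - fd j χ x from rfl, hfd, hfd,
        hshift_ne l j x (Ne.symm hlj)]
      have step := prod_sub_prod_of_eq_off (Finset.univ.erase j)
        (fun i => F i ((x + Pi.single l 1 : TorusSite d N) i)) (fun i => F i (x i)) hl (fun i _ hil => by
          show F i ((x + Pi.single l 1 : TorusSite d N) i) = F i (x i)
          rw [hshift_ne l i x hil])
      have hll : F l ((x + Pi.single l 1 : TorusSite d N) l) = F l (x l + 1) := by rw [hshift_eq]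
      rw [hll] at step
      rw [← mul_sub, step]
    rw [e, abs_mul, abs_mul]
    have hp := hP ((Finset.univ.erase j).erase l) x
    rw [abs_of_nonneg hp.1]
    calc |F j (x j + 1) - F j (x j)| * (|F l (x l + 1) - F l (x l)| * ∏ i ∈ (Finset.univ.erase j).erase l, F i (x i))
        ≤ a * (a * 1) := by
          refine mul_le_mul (h1 j (x j)) ?_ (mul_nonneg (abs_nonneg _) hp.1) ha
          exact mul_le_mul (h1 l (x l)) hp.2 hp.1 ha
      _ = a ^ 2 := by ring

/-! ## §5  The box cut-off -/

/-- ★★ **C^{1,1} PRODUCT BOX CUT-OFF ON THE TORUS.**  For a centre `z`, a radius `R` and a width `w` with `1 ≤ w ≤ R` and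
`2(R + w) + 7 ≤ N`, there is `χ : (ℤ∕N)^d → [0,1]` with `χ = 1` on the box of torus-radius `R − w + 1` around `z`
(`|valMinAbs(x_i − z_i)| + w ≤ R + 1` for all `i`), `χ = 0` as soon as one coordinate is at torus-distance `≥ R + w`,
`|∂ⱼχ| ≤ 1∕w` and `|∂ₗ∂ⱼχ| ≤ 2∕w²` for all `l, j`. [folklore] -/
theorem exists_torusBoxCutoff (z : TorusSite d N) {R w : ℕ} (hw : 1 ≤ w) (hwR : w ≤ R) (hN : 2 * (R + w) + 7 ≤ N) :
    ∃ χ : TorusSite d N → ℝ,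
      (∀ x, 0 ≤ χ x ∧ χ x ≤ 1) ∧
      (∀ x, (∀ i, (x i - z i).valMinAbs.natAbs + w ≤ R + 1) → χ x = 1) ∧
      (∀ x, (∃ i, R + w ≤ (x i - z i).valMinAbs.natAbs) → χ x = 0) ∧
      (∀ j x, |fd j χ x| ≤ 1 / w) ∧
      (∀ l j x, |fd l (fd j χ) x| ≤ 2 / (w : ℝ) ^ 2) := by
  classical
  have hw0 : (0 : ℝ) < w := by exact_mod_cast hw
  set r : ℕ → ℝ := fun m => min 1 (max 0 (((R : ℝ) + w - m) / w)) with hr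
  set g : ℕ → ℝ := fun k => (1 / (w : ℝ)) * ∑ s ∈ Finset.range w, r (k + s) with hg
  set F : Fin d → ZMod N → ℝ := fun i v => g (v - z i).valMinAbs.natAbs with hF
  have hc : ∀ (i : Fin d) (v : ZMod N), (0 ≤ F i v ∧ F i v ≤ 1) ∧ |F i (v + 1) - F i v| ≤ 1 / w ∧
      |F i (v + 1 + 1) - 2 * F i (v + 1) + F i v| ≤ 2 / (w : ℝ) ^ 2 :=
    fun i v => coordCutoff_bounds r hr g hg hw hwR hN (z i) (F i) (by rw [hF]) v
  obtain ⟨h0, hd1, hd2, hd3⟩ := prodCutoff_bounds F (by positivity : (0 : ℝ) ≤ 1 / w) (fun i v => (hc i v).1)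
    (fun i v => (hc i v).2.1) (fun i v => (hc i v).2.2) (fun x => ∏ i, F i (x i)) rfl
  refine ⟨fun x => ∏ i, F i (x i), h0, fun x hx => ?_, fun x hx => ?_, hd1, fun l j x => ?_⟩
  · exact Finset.prod_eq_one (fun i _ => (coordCutoff_eq r hr g hg hw (z i) (F i) (by rw [hF]) (x i)).1 (hx i))
  · obtain ⟨i, hi⟩ := hx
    exact Finset.prod_eq_zero (Finset.mem_univ i) ((coordCutoff_eq r hr g hg hw (z i) (F i) (by rw [hF]) (x i)).2 hi)
  · by_cases hlj : l = j
    · subst hlj; exact hd2 l x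
    · refine (hd3 l j x hlj).trans ?_
      rw [div_pow, one_pow]
      exact div_le_div_of_nonneg_right (by norm_num) (by positivity)

end Product

end Summit.QuantumFields.YangMills.Theorems.N07TorusBoxCutoff

end
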